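import Mathlib.Analysis.InnerProductSpace.PiL2
import Mathlib.Analysis.Calculus.ContDiff.Defs
import Literature.Analysis.FluidPDE.ClassicalSolution
import Literature.Analysis.FluidPDE.LerayHopf
import Literature.Analysis.FluidPDE.NSWave0
import HarnessLib

/-!
# Named fact: local-in-time classical (and Leray–Hopf) solutions for Clay data on `ℝ³`

Grounder file (D-0014 named facts) for the route `NavierStokesRegularity/TypeILiouville`,
statement item stmt-NavierStokesRegularity-0059 (`typeIliouville_local_classical`), the input of
the route's assembly item.

For `ν > 0` and a smooth, divergence-free, rapidly decaying datum `u₀ : ℝ³ → ℝ³` (Fefferman's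
hypotheses (4)), there is `T > 0` and a classical solution `(u, p)` of the unforced Navier–Stokes
system on `ℝ³ × [0, T)` with `u(0) = u₀`, which is moreover a Leray–Hopf weak solution on
`[0, T]`. In print: Leray 1934, §III ("solutions régulières", existence theorem of §19 for regular
initial data, energy equality §§15–17); Fefferman's problem description records that "(A) and (B)
hold if `[0, ∞)` is replaced by `[0, T)` for some `T > 0` depending on the data"; a modern
Sobolev-space proof is Majda–Bertozzi 2002, Thm. 3.4 (local `H^m` existence, `m ≥ 3`) with
Cor. 3.5/Prop. 3.6-type bootstrapping to `C^∞` for `H^∞` data (rapid decay (4) gives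
`u₀ ∈ H^m` for all `m`), and the classical solution restricted to a compact sub-interval of its
existence interval is Leray–Hopf (energy equality; cf. the fact
`Literature.Analysis.FluidPDE.IsClassicalNSSolutionOn.isLerayHopfOn`, Robinson–Rodrigo–Sadowski 2016, Thm. 4.6).
Because of the `∃ T`, `T` may be taken strictly inside the smooth existence interval, so all
closed-interval clauses of `IsLerayHopfOn T` are met.

Nothing is asserted; users take `(h : local_classical_lerayHopf)`.

## References

* J. Leray, *Sur le mouvement d'un liquide visqueux emplissant l'espace*, Acta Math. 63 (1934),
  §III (§§15–22).
* C. Fefferman, *Existence and smoothness of the Navier–Stokes equation*, Clay problem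
  description (2000/2006), discussion after (A)–(D).
* A. Majda, A. Bertozzi, *Vorticity and Incompressible Flow*, CUP 2002, Thm. 3.4, §3.2.
* H. Fujita, T. Kato, ARMA 16 (1964), Thm. 1.1.
-/

noncomputable section

open Set

namespace Literature.Analysis.FluidPDE

/-- NAMED FACT (local classical Leray–Hopf solution for Clay data; Leray 1934, Acta Math. 63,
§III §19 (existence of a "solution régulière" on some `[0, T)` for regular data) with §§15–17
(energy equality, hence Leray–Hopf); Majda–Bertozzi 2002, Thm. 3.4 (local `H^m(ℝ³)` existence)
bootstrapped over all `m`; Fefferman's Clay text: (A) holds with `[0, ∞)` replaced by a short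
`[0, T)`). For `ν > 0` and `u₀ : ℝ³ → ℝ³` smooth (`ContDiff ℝ ⊤`), divergence free and rapidly
decaying (Fefferman (4), `HasRapidSpatialDecay`), there are `T > 0` and `(u, p)` with
`IsClassicalNSSolutionOn (Ico 0 T) ν 0 u p`, `u 0 = u₀`, and `IsLerayHopfOn T ν 0 u₀ u`.
Users take `(h : local_classical_lerayHopf)`. [cite: Leray1934, §III §19 (with MajdaBertozzi2002 Thm 3.4)] -/
def local_classical_lerayHopf : Prop :=
  ∀ ν : ℝ, 0 < ν → ∀ u₀ : EuclideanSpace ℝ (Fin 3) → EuclideanSpace ℝ (Fin 3),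
    ContDiff ℝ (⊤ : ℕ∞) u₀ → Literature.Analysis.FluidPDE.NSWave0.IsDivFree u₀ → Literature.Analysis.FluidPDE.HasRapidSpatialDecay u₀ →
      ∃ T : ℝ, 0 < T ∧
        ∃ (u : ℝ → EuclideanSpace ℝ (Fin 3) → EuclideanSpace ℝ (Fin 3))
          (p : ℝ → EuclideanSpace ℝ (Fin 3) → ℝ),
          IsClassicalNSSolutionOn (Ico 0 T) ν 0 u p ∧ u 0 = u₀ ∧ IsLerayHopfOn T ν 0 u₀ u

end Literature.Analysis.FluidPDE

end
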